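import Literature.NumberTheory.GaloisCohomology.ArchimedeanInvariantMap
import Literature.NumberTheory.EllipticCurves.ZpExtension
import HarnessLib

/-!
# Odd levels and real places: the archimedean invariants vanish on `H²(K_w, μ_n)` for `n` odd, and
# every `ℤ_p`-extension is split at the real places (Milne ADT I Ex. 1.6 (c); Washington §13.1)

Topic `NumberTheory/GaloisCohomology`; namespace `Literature.NumberTheory.GaloisCohomology`.
Proof file (theorems only; no definition, no named fact, no instance; D-0026).  Groundwork of the
cell `bsd-cn100` (F1) campaign BEYOND its first milestone (Poitou–Tate for totally complex `K`):
the two facts that make the ODD part of the reciprocity law `∑_v inv_v = 0` insensitive to the real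
places of an arbitrary number field `K` —

* `archimedeanInvariantMap_eq_zero_of_odd`, `LocalInvariants.canonical_inl_eq_zero_of_odd` — for
  `n` odd THE archimedean invariant `inv_w : H²(K_w, μ_n) → ℤ/n` (`archimedeanInvariantMap`, the
  infinite components of `LocalInvariants.canonical`) VANISHES at every infinite place: its values are
  `2`-torsion (`two_nsmul_archimedeanInvariantMap`, `Br(ℝ) = ½ℤ/ℤ`) and `2` is invertible mod `n`;
  hence `LocalInvariants.canonical.sumInvLocalizationEqZero_of_odd_of_finite`: for odd `n` the
  reciprocity law for the canonical family reduces to its finite-place sums;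
* `ZpExtension.mem_kerSubgroup_of_isOfFinOrder`, `ZpExtension.mem_layerSubgroup_of_isOfFinOrder` —
  every element of FINITE ORDER of `Γ_K` (e.g. a complex conjugation) lies in the kernel of every
  `ℤ_p`-extension `κ : Γ_K → ℤ_p` (`ℤ_p` is torsion-free), hence in every layer subgroup
  `κ⁻¹(p^M ℤ_p) = Gal(K̄/K_M)`: the layers `K_M/K` are split at all real places (their decomposition
  groups at real places are trivial), which is the archimedean input of the cyclic reciprocity law
  (`BrauerSumInvCyclicClass`, hypothesis `hinf`) for the cyclotomic killing layers over a number field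
  with real places.

HONEST FRAMING: elementary; infrastructure for the `∀ K` form of `poitouTate_sum_localTatePairing_eq_zero`;
proves no case of BSD.

## References

* J. S. Milne, *Arithmetic Duality Theorems* (2006), Ch. I, Ex. 1.6 (c) (`Br(ℝ) = ½ℤ/ℤ`), Thm. 4.10(b).
  [MilneADT2006]
* L. C. Washington, *Introduction to Cyclotomic Fields* (1997), §13.1 (`ℤ_p`-extensions are unramified
  outside `p`, in particular at the infinite places). [Washington1997]
-/

noncomputable section

open Function NumberField IsDedekindDomain

universe u

namespace Literature.NumberTheory.GaloisCohomology

open Literature.NumberTheory.GaloisRepresentations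
open Literature.NumberTheory.GaloisRepresentations.DiscreteGaloisModule

/-! ### §1. Odd levels: the archimedean invariants vanish -/

section Odd

variable {K : Type u} [Field K] [NumberField K] {n : ℕ} [NeZero n]

omit [NeZero n] in
/-- In `ℤ/n` with `n` odd, `2 • x = 0` forces `x = 0` (`2` is a unit mod `n`). [folklore] -/
private theorem eq_zero_of_two_nsmul_eq_zero_of_odd (hn : Odd n) (x : ZMod n) (hx : 2 • x = 0) :
    x = 0 := by
  have hcop : Nat.Coprime 2 n := (Nat.coprime_two_left).2 hn
  have hu : IsUnit ((2 : ℕ) : ZMod n) := (ZMod.isUnit_iff_coprime 2 n).2 hcop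
  rw [nsmul_eq_mul] at hx
  exact (hu.mul_right_eq_zero).1 (by exact_mod_cast hx)

/-- **For `n` odd the archimedean invariant map `inv_w : H²(K_w, μ_n) → ℤ/n` vanishes** at every
infinite place `w` (its values are `2`-torsion, `two_nsmul_archimedeanInvariantMap`; `Br(ℝ)[n] = 0` for
`n` odd). [cite: MilneADT2006, Ch. I, Ex. 1.6 (c)] -/
theorem archimedeanInvariantMap_eq_zero_of_odd (hn : Odd n) (w : InfinitePlace K)
    (x : galoisCohomology ((mu K n).toLocal (Sum.inl w)) 2) : archimedeanInvariantMap K n w x = 0 :=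
  eq_zero_of_two_nsmul_eq_zero_of_odd hn _ (two_nsmul_archimedeanInvariantMap x)

/-- For `n` odd the canonical family of local invariant maps vanishes at every infinite place.
[cite: MilneADT2006, Ch. I, Ex. 1.6 (c)] -/
theorem LocalInvariants.canonical_inl_eq_zero_of_odd (hn : Odd n) (w : InfinitePlace K)
    (x : galoisCohomology ((mu K n).toLocal (Sum.inl w)) 2) :
    LocalInvariants.canonical K n (Sum.inl w) x = 0 :=
  archimedeanInvariantMap_eq_zero_of_odd hn w x

/-- **For `n` odd the reciprocity law for the canonical family reduces to its finite-place sums**: if for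
every global class `c ∈ H²(Γ_K, μ_n)` and every finite set `S` of FINITE places off which the finite
invariants vanish `∑_{v ∈ S} inv_v (loc_v c) = 0`, then `(LocalInvariants.canonical K n).SumInvLocalizationEqZero`
(the infinite places contribute `0`). [cite: MilneADT2006, Ch. I, Thm. 4.10(b) and Ex. 1.6 (c)] -/
theorem LocalInvariants.sumInvLocalizationEqZero_canonical_of_odd_of_finite (hn : Odd n)
    (h : ∀ (c : galoisCohomology (mu K n) 2) (S : Finset (HeightOneSpectrum (𝓞 K))),
      (∀ v ∉ S, localInvariantMap K n v (galoisCohomology.localization (mu K n) (Sum.inr v) 2 c) = 0) →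
        ∑ v ∈ S, localInvariantMap K n v (galoisCohomology.localization (mu K n) (Sum.inr v) 2 c) = 0) :
    (LocalInvariants.canonical K n).SumInvLocalizationEqZero := by
  classical
  intro c S hS
  -- split the sum into infinite and finite places
  have hsplit : ∑ v ∈ S, LocalInvariants.canonical K n v (galoisCohomology.localization (mu K n) v 2 c) =
      ∑ v ∈ S.filter (fun v => ∃ w, v = Sum.inr w),
        LocalInvariants.canonical K n v (galoisCohomology.localization (mu K n) v 2 c) := by
    rw [Finset.sum_filter]
    refine Finset.sum_congr rfl fun v _ => ?_
    rcases v with w | w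
    · rw [if_neg (by rintro ⟨w', h⟩; cases h)]
      exact LocalInvariants.canonical_inl_eq_zero_of_odd hn w _
    · rw [if_pos ⟨w, rfl⟩]
  rw [hsplit]
  -- the finite part is the image of a finset of finite places
  set Sf : Finset (HeightOneSpectrum (𝓞 K)) := S.preimage Sum.inr (Sum.inr_injective.injOn) with hSf
  have himg : S.filter (fun v => ∃ w, v = Sum.inr w) = Sf.image Sum.inr := by
    ext v
    simp only [Finset.mem_filter, Finset.mem_image, hSf, Finset.mem_preimage]
    constructor
    · rintro ⟨hv, w, rfl⟩; exact ⟨w, hv, rfl⟩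
    · rintro ⟨w, hw, rfl⟩; exact ⟨hw, w, rfl⟩
  rw [himg, Finset.sum_image fun x _ y _ h => Sum.inr_injective h]
  refine h c Sf fun v hv => ?_
  have hv' : (Sum.inr v : Place K) ∉ S := by
    intro h'; exact hv (by rw [hSf, Finset.mem_preimage]; exact h')
  exact hS _ hv'

end Odd

/-! ### §2. `ℤ_p`-extensions are split at the real places: finite-order elements lie in every layer -/

section ZpLayers

open Literature.NumberTheory.EllipticCurves

variable {K : Type u} [Field K] {p : ℕ} [Fact p.Prime] (κ : ZpExtension K p)

/-- **Every element of finite order of `Γ_K` lies in the kernel of every `ℤ_p`-extension** (`ℤ_p` is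
torsion-free: an element of finite order of `Multiplicative ℤ_p` is trivial).  In particular complex
conjugations lie in `Gal(K̄/K_∞)`: a `ℤ_p`-extension is split at every real place.
[cite: Washington1997, §13.1] -/
theorem ZpExtension.mem_kerSubgroup_of_isOfFinOrder {σ : Field.absoluteGaloisGroup K} (hσ : IsOfFinOrder σ) :
    σ ∈ κ.kerSubgroup := by
  rw [ZpExtension.mem_kerSubgroup]
  have h := κ.toContinuousMonoidHom.toMonoidHom.isOfFinOrder hσ
  change IsOfFinOrder (κ σ) at h
  obtain ⟨m, hm, hmσ⟩ := h.exists_pow_eq_one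
  have h' : (m : ℤ_[p]) * (κ σ).toAdd = 0 := by
    have := congrArg Multiplicative.toAdd hmσ
    rw [toAdd_pow, toAdd_one] at this
    rwa [← nsmul_eq_mul]
  rcases mul_eq_zero.1 h' with h0 | h0
  · exact absurd h0 (Nat.cast_ne_zero.2 hm.ne')
  · exact Multiplicative.toAdd.injective h0

/-- Finite-order elements of `Γ_K` lie in every layer subgroup `κ⁻¹(p^M ℤ_p) = Gal(K̄/K_M)` of a
`ℤ_p`-extension (they lie in `ker κ ≤ κ⁻¹(p^M ℤ_p)`, `kerSubgroup_le_layerSubgroup`): the layers `K_M/K`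
have trivial decomposition groups at the real places. [cite: Washington1997, §13.1] -/
theorem ZpExtension.mem_layerSubgroup_of_isOfFinOrder {σ : Field.absoluteGaloisGroup K}
    (hσ : IsOfFinOrder σ) (M : ℕ) : σ ∈ κ.layerSubgroup M :=
  κ.kerSubgroup_le_layerSubgroup M (ZpExtension.mem_kerSubgroup_of_isOfFinOrder κ hσ)

/-- An involution of `Γ_K` (e.g. a complex conjugation, `c ^ 2 = 1`) lies in every layer subgroup of every
`ℤ_p`-extension. [cite: Washington1997, §13.1] -/
theorem ZpExtension.mem_layerSubgroup_of_sq_eq_one {c : Field.absoluteGaloisGroup K} (hc : c ^ 2 = 1)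
    (M : ℕ) : c ∈ κ.layerSubgroup M :=
  ZpExtension.mem_layerSubgroup_of_isOfFinOrder κ (isOfFinOrder_iff_pow_eq_one.2 ⟨2, two_pos, hc⟩) M

end ZpLayers

end Literature.NumberTheory.GaloisCohomology

end
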